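import Mathlib
import HarnessLib
import Literature.Analysis.FluidPDE.AxisymmetricEuler
import Literature.Analysis.FluidPDE.AxisymmetricVorticityTransport
import Literature.Analysis.FluidPDE.SwirlTransportProofs
import Literature.Analysis.FluidPDE.ClassicalSolution
import Literature.Analysis.FluidPDE.IsometryInvariance
import Literature.Analysis.FluidPDE.FlatSwirlGauge
import Literature.Analysis.FluidPDE.VectorCalculus
import Summits.NavierStokesRegularity.NavierStokesRegularity.Theorems.PoloidalWindowDoorPoloidalWindowRigidityScrewGlue

/-!
# Route `PoloidalWindowDoor`, crux `PoloidalWindowRigidity` (K2, stmt-NavierStokesRegularity-19708), line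
# `slicesharp-screw` — stub L3 `stub_screwPressure`: the screw component of `∇p` is spatially constant

Cell ns-regularity-ideate, seat ns-poloidal-K2-p3 (stub-worker; registered stub of the K2 lead's skeleton
`slicesharp-screw` rev 4, sha16 04533a4f459e0895, signature VERBATIM; lands `--supports` the crux).

**Statement (L3).**  Along a classical Navier–Stokes flow `(u, p)` (viscosity `ν`, zero force) on an open time set
`S` whose velocity slices are invariant under the screw motions `S_a : y ↦ c + R_{κa}(y − c) + a e₃` of pitch `κ`
about the vertical axis through `c` (`u(t, S_a y) = R_{κa} u(t, y)`), the screw component of the pressure gradient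
is spatially constant on every slice: `⟪∇p(t, x), e₃ + κ J(x − c)⟫ = ⟪∇p(t, c), e₃⟫`.

**Proof.**  (i) `∇p = νΔu − ∂ₜu − (u·∇)u` (momentum) is screw-EQUIVARIANT, `∇p(t, S_a y) = R_{κa} ∇p(t, y)`:
each operator is covariant under the affine isometry `S_a = R_{κa}(·) + d_a` — the time derivative by linearity
(`R` is a continuous linear map, `S` is open), the convective term by the chain rule `Du(S_a y) ∘ R = R ∘ Du(y)`, the
Laplacian by the tree's `laplacian_comp_linearIsometryEquiv_symm` / `laplacian_comp_add_const` /
`laplacian_CLE_comp_left` (`gradient_screw_equivariant`).  (ii) Hence the `C¹` field `Q = ∇p(t, ·)` is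
screw-invariant, and the kinematic identity of `…ScrewGlue.fderiv_screwComponent` gives
`D⟪Q, h⟫(y)[w] = ⟪w × h(y), curl Q(y)⟫ = 0` because `curl ∇p = 0` (`curl_gradient_eq_zero_holds`); so `⟪∇p(t,·), h⟫`
has zero derivative and is constant (`is_const_of_fderiv_eq_zero`), equal to its value `⟪∇p(t,c), e₃⟫` at the axis
point (`h(c) = e₃`).

WHAT THIS IS NOT: not a claim about Navier–Stokes regularity — a registered support stub (a symmetry computation
for classical solutions) of a door route's crux (bears_on LADDER-NS N0, rung N0-LocalTubeDoorPoloidal).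
-/

noncomputable section

-- the summit and its single sub-problem share the name (CONVENTIONS §1), as in every Theorems file
set_option linter.dupNamespace false

namespace Summit.NavierStokesRegularity.NavierStokesRegularity.Theorems.PoloidalWindowDoorPoloidalWindowRigidityScrewPressure

open MeasureTheory Set Function Filter Topology TopologicalSpace Metric InnerProductSpace
open scoped RealInnerProductSpace InnerProductSpace Laplacian ContDiff
open Literature.Analysis Literature.Analysis.FluidPDE
open Summit.NavierStokesRegularity.NavierStokesRegularity.Theorems.PoloidalWindowDoorPoloidalWindowRigidityScrewGlue

/-! ### Screw equivariance of the pressure gradient -/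

/-- The screw motion is an affine isometry: `c + R_θ(y − c) + a e₃ = R_θ y + (c − R_θ c + a e₃)`. -/
theorem screwMotion_eq_rot_add (θ a : ℝ) (c y : EuclideanSpace ℝ (Fin 3)) :
    c + rotZ θ (y - c) + a • (EuclideanSpace.single 2 (1 : ℝ) : EuclideanSpace ℝ (Fin 3)) =
      rotZLIE θ y + (c - rotZLIE θ c + a • (EuclideanSpace.single 2 (1 : ℝ) : EuclideanSpace ℝ (Fin 3))) := by
  have h : rotZ θ (y - c) = rotZLIE θ y - rotZLIE θ c := by
    rw [← rotZLIE_apply, map_sub]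
  rw [h]; abel

/-- **The pressure gradient of a screw-invariant classical flow is screw-equivariant**:
`∇p(t, S_a y) = R_{κa} ∇p(t, y)` for `S_a y = c + R_{κa}(y − c) + a e₃` (momentum equation + covariance of
`∂ₜ`, `(u·∇)u`, `Δ` under the affine isometry `S_a`). -/
theorem gradient_screw_equivariant {S : Set ℝ} (hSo : IsOpen S) {ν : ℝ}
    {u : ℝ → EuclideanSpace ℝ (Fin 3) → EuclideanSpace ℝ (Fin 3)} {p : ℝ → EuclideanSpace ℝ (Fin 3) → ℝ}
    (hns : IsClassicalNSSolutionOn S ν 0 u p) (κ : ℝ) (c : EuclideanSpace ℝ (Fin 3))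
    (hinv : ∀ t ∈ S, ∀ (a : ℝ) (y : EuclideanSpace ℝ (Fin 3)),
      u t (c + rotZ (κ * a) (y - c) + a • EuclideanSpace.single 2 (1 : ℝ)) = rotZ (κ * a) (u t y))
    {t : ℝ} (ht : t ∈ S) (a : ℝ) (y : EuclideanSpace ℝ (Fin 3)) :
    gradient (p t) (c + rotZ (κ * a) (y - c) + a • EuclideanSpace.single 2 (1 : ℝ)) =
      rotZ (κ * a) (gradient (p t) y) := by
  have hS : UniqueDiffOn ℝ S := hSo.uniqueDiffOn
  set R : EuclideanSpace ℝ (Fin 3) ≃ₗᵢ[ℝ] EuclideanSpace ℝ (Fin 3) := rotZLIE (κ * a) with hRdef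
  set d : EuclideanSpace ℝ (Fin 3) := c - R c + a • (EuclideanSpace.single 2 (1 : ℝ) : EuclideanSpace ℝ (Fin 3))
    with hd
  have hSa : ∀ z : EuclideanSpace ℝ (Fin 3),
      c + rotZ (κ * a) (z - c) + a • (EuclideanSpace.single 2 (1 : ℝ) : EuclideanSpace ℝ (Fin 3)) = R z + d :=
    fun z => screwMotion_eq_rot_add (κ * a) a c z
  have hRz : ∀ z : EuclideanSpace ℝ (Fin 3), rotZ (κ * a) z = R z := fun z => rfl
  rw [hSa, hRz]
  set v : EuclideanSpace ℝ (Fin 3) → EuclideanSpace ℝ (Fin 3) := u t with hv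
  -- invariance of the slice, as an identity of functions
  have hfun : ∀ z, v (R z + d) = R (v z) := fun z => by
    rw [hv, ← hSa z, hinv t ht a z, hRz]
  have hfunext : (fun z => v (R z + d)) = fun z => R (v z) := funext hfun
  have hv2 : ContDiff ℝ 2 v := contDiff_infty.1 (hns.contDiff_velocity ht) 2
  have hvd : ∀ z, DifferentiableAt ℝ v z := fun z => (hv2.differentiable two_ne_zero) z
  -- ## the Laplacian: `Δv (R y + d) = R (Δv y)`
  have hΔ : (Δ v) (R y + d) = R ((Δ v) y) := by
    have h1 : (Δ (fun z => v (R z + d))) y = (Δ v) (R y + d) := by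
      have e : (fun z => v (R z + d)) = fun z => (fun w => v (w + d)) (R.symm.symm z) := by
        funext z; rw [LinearIsometryEquiv.symm_symm]
      rw [e, laplacian_comp_linearIsometryEquiv_symm R.symm (fun w => v (w + d)) y,
        LinearIsometryEquiv.symm_symm, laplacian_comp_add_const]
    have h2 : (Δ (fun z => R (v z))) y = R ((Δ v) y) := by
      have e : (fun z => R (v z)) = ⇑R.toContinuousLinearEquiv ∘ v := rfl
      rw [e, InnerProductSpace.laplacian_CLE_comp_left, Function.comp_apply]
      rfl
    rw [← h1, hfunext, h2]
  -- ## the derivative: `Dv(R y + d) (R w) = R (Dv(y) w)`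
  have hD : ∀ w, fderiv ℝ v (R y + d) (R w) = R (fderiv ℝ v y w) := fun w => by
    have haff : HasFDerivAt (fun z : EuclideanSpace ℝ (Fin 3) => R z + d)
        (R : EuclideanSpace ℝ (Fin 3) →L[ℝ] EuclideanSpace ℝ (Fin 3)) y :=
      (R : EuclideanSpace ℝ (Fin 3) →L[ℝ] EuclideanSpace ℝ (Fin 3)).hasFDerivAt.add_const d
    have hL : HasFDerivAt (fun z => v (R z + d))
        ((fderiv ℝ v (R y + d)).comp (R : EuclideanSpace ℝ (Fin 3) →L[ℝ] EuclideanSpace ℝ (Fin 3))) y :=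
      (hvd (R y + d)).hasFDerivAt.comp y haff
    have hR' : HasFDerivAt (fun z => R (v z))
        ((R : EuclideanSpace ℝ (Fin 3) →L[ℝ] EuclideanSpace ℝ (Fin 3)).comp (fderiv ℝ v y)) y :=
      (R : EuclideanSpace ℝ (Fin 3) →L[ℝ] EuclideanSpace ℝ (Fin 3)).hasFDerivAt.comp y (hvd y).hasFDerivAt
    rw [hfunext] at hL
    have heq := hL.unique hR'
    have := congrArg (fun L : EuclideanSpace ℝ (Fin 3) →L[ℝ] EuclideanSpace ℝ (Fin 3) => L w) heq
    simpa using this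
  -- ## the convective term
  have hC : convect v v (R y + d) = R (convect v v y) := by
    rw [convect, convect, hfun y, hD]
  -- ## the time derivative
  have hT : timeDerivWithin S u t (R y + d) = R (timeDerivWithin S u t y) := by
    simp only [timeDerivWithin_apply]
    have hcongr : derivWithin (fun s => u s (R y + d)) S t = derivWithin (fun s => R (u s y)) S t := by
      refine derivWithin_congr (fun s hs => ?_) ?_
      · rw [← hSa y, hinv s hs a y, hRz]
      · rw [← hSa y, hinv t ht a y, hRz]
    have hdy : HasDerivWithinAt (fun s => u s y) (derivWithin (fun s => u s y) S t) S t :=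
      (hns.smooth_velocity.differentiableWithinAt_time ht y).hasDerivWithinAt
    have h3 := ((R : EuclideanSpace ℝ (Fin 3) →L[ℝ] EuclideanSpace ℝ (Fin 3)).hasFDerivAt.comp_hasDerivWithinAt t
      hdy).derivWithin (hS t ht)
    rw [hcongr]
    exact h3
  -- ## the momentum equation at `R y + d` and at `y`
  have hm1 := hns.momentum t ht (R y + d)
  have hm2 := hns.momentum t ht y
  simp only [Pi.zero_apply, add_zero] at hm1 hm2
  have e1 : gradient (p t) (R y + d) = ν • (Δ (u t)) (R y + d) -
      (timeDerivWithin S u t (R y + d) + convect (u t) (u t) (R y + d)) := by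
    rw [hm1]; exact (sub_sub_cancel _ _).symm
  have e2 : gradient (p t) y = ν • (Δ (u t)) y - (timeDerivWithin S u t y + convect (u t) (u t) y) := by
    rw [hm2]; exact (sub_sub_cancel _ _).symm
  rw [e1, e2, ← hv, hΔ, hC, hT, map_sub, map_add, LinearIsometryEquiv.map_smul]

/-! ### The registered stub -/

/-- **STUB L3 `stub_screwPressure` (registered signature verbatim, skeleton `slicesharp-screw` rev 4).**  Along a
classical Navier–Stokes flow (viscosity `ν`, zero force) on an open time set whose velocity slices are invariant
under the screw motions of pitch `κ` about the vertical axis through `c`, the screw component of the pressure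
gradient `⟪∇p, e₃ + κ J(· − c)⟫` is SPATIALLY CONSTANT on every slice: `∇p(t,·)` is a screw-invariant `C¹` field
(`gradient_screw_equivariant`), so `D⟪∇p, h⟫ = ⟪· × h, curl ∇p⟫ = 0` (`…ScrewGlue.fderiv_screwComponent`,
`curl_gradient_eq_zero_holds`) and `⟪∇p(t,·), h⟫` is constant, equal to `⟪∇p(t,c), e₃⟫`. -/
theorem stub_screwPressure :
    ∀ (S : Set ℝ), IsOpen S → ∀ (ν : ℝ)
      (u : ℝ → EuclideanSpace ℝ (Fin 3) → EuclideanSpace ℝ (Fin 3)) (p : ℝ → EuclideanSpace ℝ (Fin 3) → ℝ),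
      Literature.Analysis.FluidPDE.IsClassicalNSSolutionOn S ν 0 u p →
      ∀ (κ : ℝ) (c : EuclideanSpace ℝ (Fin 3)),
      (∀ t ∈ S, ∀ (a : ℝ) (y : EuclideanSpace ℝ (Fin 3)),
        u t (c + Literature.Analysis.FluidPDE.rotZ (κ * a) (y - c) + a • EuclideanSpace.single 2 (1 : ℝ)) =
          Literature.Analysis.FluidPDE.rotZ (κ * a) (u t y)) →
      ∀ t ∈ S, ∀ x : EuclideanSpace ℝ (Fin 3),
        ⟪gradient (p t) x, (EuclideanSpace.single 2 (1 : ℝ) : EuclideanSpace ℝ (Fin 3)) + κ • Literature.Analysis.FluidPDE.rotGen (x - c)⟫_ℝ =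
          ⟪gradient (p t) c, (EuclideanSpace.single 2 (1 : ℝ) : EuclideanSpace ℝ (Fin 3))⟫_ℝ := by
  intro S hSo ν u p hns κ c hinv t ht x
  -- the pressure gradient is a screw-invariant `C¹` field with vanishing curl
  have hequi : ∀ (a : ℝ) (y : EuclideanSpace ℝ (Fin 3)),
      gradient (p t) (c + rotZ (κ * a) (y - c) + a • EuclideanSpace.single 2 (1 : ℝ)) =
        rotZ (κ * a) (gradient (p t) y) := fun a y => gradient_screw_equivariant hSo hns κ c hinv ht a y
  have hp2 : ContDiff ℝ 2 (p t) := contDiff_infty.1 (hns.contDiff_pressure ht) 2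
  have hQ1 : ContDiff ℝ 1 (gradient (p t)) := by
    have e : gradient (p t) = fun x => (InnerProductSpace.toDual ℝ (EuclideanSpace ℝ (Fin 3))).symm
        (fderiv ℝ (p t) x) := rfl
    rw [e]
    exact (InnerProductSpace.toDual ℝ (EuclideanSpace ℝ (Fin 3))).symm.contDiff.comp
      (hp2.fderiv_right (m := 1) le_rfl)
  have hcurl : ∀ y, curl (gradient (p t)) y = 0 := fun y => curl_gradient_eq_zero_holds (p t) hp2 y
  -- the screw component of `∇p` has zero derivative, hence is constant
  have hD : ∀ y, fderiv ℝ (fun z => ⟪gradient (p t) z,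
      (EuclideanSpace.single 2 (1 : ℝ) : EuclideanSpace ℝ (Fin 3)) + κ • rotGen (z - c)⟫_ℝ) y = 0 := fun y => by
    ext w
    rw [fderiv_screwComponent hQ1 hequi y w, hcurl y, inner_zero_right]
    rfl
  have hdiff : Differentiable ℝ (fun z => ⟪gradient (p t) z,
      (EuclideanSpace.single 2 (1 : ℝ) : EuclideanSpace ℝ (Fin 3)) + κ • rotGen (z - c)⟫_ℝ) :=
    (hQ1.differentiable one_ne_zero).inner ℝ ((contDiff_screwField_centre κ c).differentiable one_ne_zero)
  have hconst := is_const_of_fderiv_eq_zero hdiff hD x c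
  rw [hconst, screwField_centre_self]

end Summit.NavierStokesRegularity.NavierStokesRegularity.Theorems.PoloidalWindowDoorPoloidalWindowRigidityScrewPressure

end
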